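import Literature.AnabelianGeometry.EtaleTheta.Discharge.Sec5Thm57GenuineBindersA
import Literature.AnabelianGeometry.EtaleTheta.Discharge.Sec5Thm57FinalKnitReduced
import Literature.AnabelianGeometry.EtaleTheta.Discharge.Sec3Thm37StandardWeak
import Literature.AnabelianGeometry.EtaleTheta.Discharge.Sec5OfThetaSettingConstantsDictionary
import Literature.AnabelianGeometry.EtaleTheta.Discharge.Sec5OriginClausesOfThetaSetting

/-!
# [EtTh] §5, Theorem 5.7 — the binders (A) at the genuine instance, part 2: `hnd` ⟸ `Thm44Hyp` at the canonical vocabularies; the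
# FINAL KNIT `…_final_reduced` re-keyed; and the §1 SETTING `(Π^tp_X̲̲, Cu.thetaEnvTower τ hC hS, id)`, `A_⊙^bs := Ÿ̲̲`, where the Π-side
# inputs `hYdd`, `hY₁` are THEOREMS (pp. 305, 319, 322, 330–332 / PDF pp. 79, 93, 96, 104–106)

Mochizuki, *The étale theta function and its Frobenioid-theoretic manifestations*, Publ. RIMS **45** (2009)
[cite: MochizukiEtTh2009, Thm 5.7 p.329–330 (PDF pp.103–104); Lem 5.8 p.331 (PDF p.105); Lem 5.9 (iv) p.332 (PDF p.106); §5 p.322 (PDF p.96)].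
abc-iut cell, layer L2, seat abc-iut-w5-d123 (gen 5); abc-iut-L2-lead (gen 4) ROW **R335 «THM 5.7 (A)-BINDERS AT THE GENUINE INSTANCE»**,
companion of `Discharge/Sec5Thm57GenuineBindersA.lean` (this seat: `hN` gone, `hinj` ⟸ {`hc₀`, `ht`}, `hfac₁` ⟸ {`hP34`, `ecn`, `hYdd`},
`hgc₁` ⟸ {`ConstantsDictionary`, `hY₁`} for the GENERIC connected base).  PROOF-ONLY knit (0 definitions, 0 new named facts; nothing
landed is edited or restated).

THREE PARTS.  (1) `hnd_of_thm44Hyp_treeMonoidVocabWeak` / `…_treeMonoidVocab` — the LAST binder of (A), `hnd` («`Φ` non-dilating»,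
print's standing hypothesis of Thm. 3.7 (ii) / Thm. 4.4), is NOT derivable from the Def. 3.6 (ii) data
(`TemperedFrobenioid.not_isNonDilatingOn_divisorMonoid`) but IS the field `Thm44Hyp.isNonDilating₁` of the Thm. 4.4 hypothesis bundle
that every final Thm. 5.7 closer already carries, as soon as the realified divisor data are typed over the tree's canonical [FrdI] monoid
vocabularies `treeMonoidVocab` / `treeMonoidVocabWeak` (abc-iut-L2-d2's `isNonDilatingOn_iff_pull(_weak)`, any category vocabulary) —
so at those vocabularies (A) has NO residual beyond the §4 package.  (2) `thetaRootPreservedAll_ofConnectedTemperoidYddFamily_final_reduced_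
genuine_of_constantsDictionary` — abc-iut-L2-d4's closer of record `…_final_reduced` (p447315, FILE 4; `hN` already gone there) with `hinj`,
`hgc₁`, `hfac₁` RE-KEYED exactly as in part 1 (generic base, morphism universe `0`).  (3) The §1 Setting:
here the base, the §2 tower and the identification are PINNED to the §1 Setting — abc-iut-L2-t4's tower of the Setting
`ThetaFrobenioidTower.ofThetaSettingFamily` (`Sec5OfThetaSetting.lean`; IS `ofConnectedTemperoidFamily` at `(Π^tp_X̲̲, Cu.thetaEnvTower τ hC hS,
id)`, `rfl`) over `BiKummerSetting.mkOfConnectedTemperoidYddTower` (`A_⊙^bs := Ÿ̲̲`, §5 p.322) with the constants pulled back from `X₀`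
(abc-iut-w4-d008's shape `B(t_N)^× ∘ c₀`):
* `hYdd_thetaEnvTower_ofThetaSetting` — the input `hYdd` of the re-keyed `hfac₁` («`aug(Π^tp_Ÿ̲̲)` exhausts `aug(Π^tp_X̲̲)`», `Ÿ̲̲`
  geometrically connected over `K = K̈`) is abc-iut-L2-t4's THEOREM `hYdd_ofThetaSetting` (FIELD `map_aug_Ydduu`, Prop. 2.2 (iii));
* `identifiesPiY_atLevelOne_ofThetaSettingYddFamily` — the input `hY₁` of the re-keyed `hgc₁` for `ι₁ := id`, `μ₁ := τ.mod 1` is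
  abc-iut-L2-t4's THEOREM `identifiesPiY_ofThetaSettingData` (the level `1` of the tower IS `ofThetaSettingData (τ.mod 1)`,
  `atLevel_ofThetaSettingFamily_eq`, `rfl`; `𝔉.PiY = Π^tp_Y̲̲ = T.PiY` via `Ker(Π ↠ ℤ)`);
* **`thetaRootPreservedAll_ofThetaSettingYddFamily_ofAnchored_genuine_of_constantsDictionary`** — abc-iut-L2-d4's anchored capstone
  (p442166) for the tower of the Setting with `hN` GONE, `hinj` ⟸ {`hc₀`, `ht`}, `hfac₁` ⟸ {`hP34`, `ecn`} (`hYdd` discharged here),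
  `hgc₁` ⟸ {`hD₁ : ConstantsDictionary` at the first root, `hY₁`} (`hY₁` a theorem for `ι₁ := id` by the previous item; kept as a binder
  so that any reading `(μ₁, ι₁)` of the level-`1` constants is admissible).
RESIDUAL of (A) at an abstract monoid vocabulary: `hnd` ALONE (gone at `treeMonoidVocab(Weak)` by part (1)).  Untouched binders (not (A)):
seeds `αs`, `βs`, `hdivcap₁`/`hdivcup₁` (Prop. 5.3 (vi), R232), `hP24` (Prop. 2.4, G-L6d6-2 shape), `hfam` resp. the §4 package of p447315,
(C) `hc` (Cor. 2.8 (i), R336), and the junction data of record `ConstantsDictionary` / `Prop34Cnst` / `ecn` / `ht`.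
HONEST FRAMING: kernel-checked composition of landed theorems under named hypotheses for data so parametrised (the class
`TemperedFrobenioid T₀ (ConnectedPart (BTemp Π^tp_X̲̲)) VD` is not shown inhabited for an actual curve; the dictionary is not constructed);
nothing asserts any result of [EtTh] unconditionally; typed ≠ discharged; no side taken on anything downstream ([IUTchIII] Cor. 3.12). -/

noncomputable section

namespace Literature.AnabelianGeometry.EtaleTheta

open CategoryTheory Opposite Literature.AlgebraicGeometry.Frobenioids Literature.AnabelianGeometry.SemiGraphs
  Literature.AnabelianGeometry.SemiGraphs.GaloisObjects

universe u₀ v₀ w u v u₁ v₁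

namespace ThetaFrobenioidTower

/-! ## The last binder of (A), `hnd`, at the tree's CANONICAL monoid vocabularies: it is the field `isNonDilating₁` of the Thm. 4.4
hypothesis bundle `Thm44Hyp` that every final Thm. 5.7 closer carries ("whose divisor monoid `Φ_i` is … non-dilating", Thm. 4.4 p.319) -/

section NonDilating

/-- **`hnd` ⟸ `Thm44Hyp` at `treeMonoidVocabWeak`** (abc-iut-L2-d2's weak [FrdI] monoid vocabulary — the reading at tempered coverings with
infinitely many special-fibre components): print's "`Φ₁` non-dilating" carried by `Thm44Hyp.isNonDilating₁` IS the tree's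
`IsNonDilatingOn S₁.tf.divisorMonoid` (`isNonDilatingOn_iff_pull_weak`, any category vocabulary) — so in abc-iut-L2-d4's `…_final_reduced`
(which takes `h44 : Thm44Hyp S S`) the binder `hnd` is REDUNDANT there.  [cite: MochizukiEtTh2009, Thm 4.4 p.319 (PDF p.93); Thm 3.7 (ii) p.305 (PDF p.79)] -/
theorem hnd_of_thm44Hyp_treeMonoidVocabWeak {K₁ K₂ : Type u₀} [Field K₁] [Field K₂]
    {X₁ : SemiGraphs.TemperedArithmeticGroup.{u₀} K₁} {X₂ : SemiGraphs.TemperedArithmeticGroup.{u₀} K₂}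
    {D₀ D₀' : Type u₀} [Category.{v₀} D₀] [Category.{v₀} D₀']
    {T₁ : RealifiedDivisorMonoids (D₀ := D₀) treeMonoidVocabWeak.{w}} {T₂ : RealifiedDivisorMonoids (D₀ := D₀') treeMonoidVocabWeak.{w}}
    {D₁ D₂ : Type u} [Category.{v} D₁] [Category.{v} D₂] {VD₁ : FrdICatStub.{u, v, w} D₁} {VD₂ : FrdICatStub.{u, v, w} D₂}
    {S₁ : BiKummerSetting X₁ T₁ D₁ VD₁} {S₂ : BiKummerSetting X₂ T₂ D₂ VD₂} (h44 : BiKummerSetting.Thm44Hyp S₁ S₂) :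
    IsNonDilatingOn S₁.tf.divisorMonoid :=
  S₁.tf.isNonDilatingOn_iff_pull_weak.mpr h44.isNonDilating₁

/-- **`hnd` ⟸ `Thm44Hyp` at `treeMonoidVocab`** (the tree's canonical [FrdI] monoid vocabulary, `FrdIVocabulary.lean`): the same, via
`TemperedFrobenioid.isNonDilatingOn_iff_pull`.  [cite: MochizukiEtTh2009, Thm 4.4 p.319 (PDF p.93); Thm 3.7 (ii) p.305 (PDF p.79)] -/
theorem hnd_of_thm44Hyp_treeMonoidVocab {K₁ K₂ : Type u₀} [Field K₁] [Field K₂]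
    {X₁ : SemiGraphs.TemperedArithmeticGroup.{u₀} K₁} {X₂ : SemiGraphs.TemperedArithmeticGroup.{u₀} K₂}
    {D₀ D₀' : Type u₀} [Category.{v₀} D₀] [Category.{v₀} D₀']
    {T₁ : RealifiedDivisorMonoids (D₀ := D₀) treeMonoidVocab.{w}} {T₂ : RealifiedDivisorMonoids (D₀ := D₀') treeMonoidVocab.{w}}
    {D₁ D₂ : Type u} [Category.{v} D₁] [Category.{v} D₂] {VD₁ : FrdICatStub.{u, v, w} D₁} {VD₂ : FrdICatStub.{u, v, w} D₂}
    {S₁ : BiKummerSetting X₁ T₁ D₁ VD₁} {S₂ : BiKummerSetting X₂ T₂ D₂ VD₂} (h44 : BiKummerSetting.Thm44Hyp S₁ S₂) :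
    IsNonDilatingOn S₁.tf.divisorMonoid :=
  S₁.tf.isNonDilatingOn_iff_pull.mpr h44.isNonDilating₁

end NonDilating

/-! ## abc-iut-L2-d4's closer of record `…_final_reduced` (p447315, FILE 4) with the derivable binders of (A) re-keyed (generic base) -/

section FinalReduced

variable {K : Type} [Field K] {X : SemiGraphs.TemperedArithmeticGroup.{0} K} {D₀ : Type} [Category.{v₀} D₀]
  {V : FrdIMonoidStub.{0}} {T₀ : RealifiedDivisorMonoids (D₀ := D₀) V}
  {VD : FrdICatStub.{1, 0, 0} (ConnectedPart (BTemp X.Pi))}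
  {tf : TemperedFrobenioid T₀ (ConnectedPart (BTemp X.Pi)) VD} {hZ : tf.monoidType = MonoidType.Z}
  {hP : ∀ A : (ConnectedPart (BTemp X.Pi))ᵒᵖ, IsPerfect (tf.Φ.carrier A)}
  {NH : Subgroup (Field.absoluteGaloisGroup K) → tf.category → ℕ+ → Prop}
  {E : Set ℕ+} (𝒯 : ThetaEnvTower.{0} E) (ιX : 𝒯.PiX ≃ₜ* X.Pi)
  {pullFrac : ∀ {A A' : (BiKummerSetting.mkOfConnectedTemperoidYddTower X tf hZ hP NH 𝒯 ιX).C} (_ : A' ⟶ A),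
    (BiKummerSetting.mkOfConnectedTemperoidYddTower X tf hZ hP NH 𝒯 ιX).biratUnits A →
      (BiKummerSetting.mkOfConnectedTemperoidYddTower X tf hZ hP NH 𝒯 ιX).biratUnits A'}
  {lv : ℕ+}
  {θ : (BiKummerSetting.mkOfConnectedTemperoidYddTower X tf hZ hP NH 𝒯 ιX).biratUnits
    (BiKummerSetting.mkOfConnectedTemperoidYddTower X tf hZ hP NH 𝒯 ιX).Aodot}
  {Bl : (BiKummerSetting.mkOfConnectedTemperoidYddTower X tf hZ hP NH 𝒯 ιX).C}
  {Pl : (BiKummerSetting.mkOfConnectedTemperoidYddTower X tf hZ hP NH 𝒯 ιX).FractionPair θ Bl}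
  {Rl : (BiKummerSetting.mkOfConnectedTemperoidYddTower X tf hZ hP NH 𝒯 ιX).NthRoot θ Pl lv pullFrac}
  (h : ModelFrobenioid.Hypotheses tf.divisorMonoid tf.ratFnFunctor)
  (Q : FrobenioidTheta.ThetaSubquotientStub.{0} (ConnectedPart (BTemp X.Pi))) (odd_l : Odd (lv : ℕ))
  (R : ∀ N : ℕ+, (BiKummerSetting.mkOfConnectedTemperoidYddTower X tf hZ hP NH 𝒯 ιX).NthRoot Rl.root Rl.pair N pullFrac)
  (K' : Type) [Field K'] {X₀ : ConnectedPart (BTemp X.Pi)}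
  (hX₀ : ∀ Y : ConnectedPart (BTemp X.Pi), Subsingleton (Y ⟶ X₀)) (t : ∀ N : ℕ+, (R N).BN.base ⟶ X₀)
  (c₀ : K'ˣ →* (tf.ratFnFunctor.obj (op X₀))ˣ)
  (hc₀ : Function.Injective c₀) (ht : ∀ N : ℕ+, Function.Injective (tf.ratFnFunctor.map (t N).op).hom)
  (hinvc : ∀ (N : ℕ+) (g : Aut (R N).AN.base),
    pull tf.divisorMonoid g.hom (ModelFrobenioid.div (R N).pair.num) = ModelFrobenioid.div (R N).pair.num)
  (hinvp : ∀ (N : ℕ+) (y : 𝒯.PiX), y ∈ 𝒯.PiYdd →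
    pull tf.divisorMonoid ((BiKummerSetting.mkOfConnectedTemperoidYddTower X tf hZ hP NH 𝒯 ιX).galoisSurj (R N).AN.base
      (R N).αData.isGalois (ιX y)).hom (ModelFrobenioid.div (R N).pair.den) = ModelFrobenioid.div (R N).pair.den)
  (α : ∀ {N N' : ℕ+}, (N : ℕ) ∣ N' → ((R N').AN ⟶ (R N).AN))
  (β : ∀ {N N' : ℕ+}, (N : ℕ) ∣ N' → ((R N').BN ⟶ (R N).BN))
  (comm_sCap : ∀ {N N' : ℕ+} (hd : (N : ℕ) ∣ N'), (R N').pair.num ≫ β hd = α hd ≫ (R N).pair.num)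
  (comm_sCup : ∀ {N N' : ℕ+} (hd : (N : ℕ) ∣ N'), (R N').pair.den ≫ β hd = α hd ≫ (R N).pair.den)
  (isIsometry_α : ∀ {N N' : ℕ+} (hd : (N : ℕ) ∣ N'),
    ((BiKummerSetting.mkOfConnectedTemperoidYddTower X tf hZ hP NH 𝒯 ιX).sec5Stub h).pre.IsIsometry (α hd))
  (degFr_α : ∀ {N N' : ℕ+} (hd : (N : ℕ) ∣ N'),
    (((BiKummerSetting.mkOfConnectedTemperoidYddTower X tf hZ hP NH 𝒯 ιX).sec5Stub h).pre.degFr (α hd) : ℕ) * N = N')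
  (isIsometry_β : ∀ {N N' : ℕ+} (hd : (N : ℕ) ∣ N'),
    ((BiKummerSetting.mkOfConnectedTemperoidYddTower X tf hZ hP NH 𝒯 ιX).sec5Stub h).pre.IsIsometry (β hd))
  (degFr_β : ∀ {N N' : ℕ+} (hd : (N : ℕ) ∣ N'),
    (((BiKummerSetting.mkOfConnectedTemperoidYddTower X tf hZ hP NH 𝒯 ιX).sec5Stub h).pre.degFr (β hd) : ℕ) * N = N')
  (baseFrob_α : ∀ {N N' : ℕ+} (hd : (N : ℕ) ∣ N'),
    (BiKummerSetting.mkOfConnectedTemperoidYddTower X tf hZ hP NH 𝒯 ιX).IsOfBaseFrobeniusType (α hd))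
  -- the §1 Setting against which the constants of `B_1` are read (abc-iut-L2-t8's model `Cu.thetaEnvData μ₁ hC hS`)
  {p : ℕ} [Fact p.Prime] {DS : ThetaSetting p} {ES : DS.EtaleThetaData} {l' : ℕ} (Cu : ES.DoubleUnderline l')
  (hC : DS.Compat) (hS : DS.Sec2Hyps)
  (h44 : BiKummerSetting.Thm44Hyp (BiKummerSetting.mkOfConnectedTemperoidYddTower X tf hZ hP NH 𝒯 ιX)
    (BiKummerSetting.mkOfConnectedTemperoidYddTower X tf hZ hP NH 𝒯 ιX))
  (ψ : ∀ A : (BiKummerSetting.mkOfConnectedTemperoidYddTower X tf hZ hP NH 𝒯 ιX).C,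
    (BiKummerSetting.mkOfConnectedTemperoidYddTower X tf hZ hP NH 𝒯 ιX).biratUnits A ≃*
      (BiKummerSetting.mkOfConnectedTemperoidYddTower X tf hZ hP NH 𝒯 ιX).biratUnits (h44.Ψ.functor.obj A))
  (hpull : ∀ {A A' : (BiKummerSetting.mkOfConnectedTemperoidYddTower X tf hZ hP NH 𝒯 ιX).C} (φ : A' ⟶ A)
    (f : (BiKummerSetting.mkOfConnectedTemperoidYddTower X tf hZ hP NH 𝒯 ιX).biratUnits A),
      ψ A' (pullFrac φ f) = pullFrac (h44.Ψ.functor.map φ) (ψ A f))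
  (hii : BiKummerSetting.Thm44_ii h44 ψ) (h3 : h44.PreservesFrobeniusStructure) (h4b : h44.PreservesBaseFrobeniusTypeData)
  (h8 : h44.PreservesAmple) (h15a : h44.PreservesFixedByHA ψ) (h15 : h44.PreservesSaturated ψ)
  -- (B1)/(B1′): the Def. 4.1 (iv) datum of each transition `α_{1,N}` and its pull-back compatibility
  (D : ∀ N : ℕ+, (BiKummerSetting.mkOfConnectedTemperoidYddTower X tf hZ hP NH 𝒯 ιX).BaseFrobeniusTypeData (α (one_dvd_level N)))


include hX₀ h hc₀ ht comm_sCap comm_sCup isIsometry_α degFr_α isIsometry_β degFr_β hpull hii h3 h4b h8 h15a h15 in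
/-- **[EtTh] Theorem 5.7 at the genuine connected tower — abc-iut-L2-d4's FINAL KNIT `…_final_reduced` (p447315) with the derivable
binders of (A) RE-KEYED onto the landed producers**: `hinj` ⟸ {`hc₀`, `ht`} (abc-iut-w4-d008 `unitsMap_comp_injective`); `hgc₁` ⟸ {the ONE
junction binder `hD₁ : ConstantsDictionary` at the first root, `hY₁`} (abc-iut-L2-t11 `ConstantsDictionary.hgc`, via
`hgc_atLevelOne_of_constantsDictionary`); `hfac₁` ⟸ {`hP34`, `ecn`, `hYdd`} (abc-iut-w4-d008 `hfac_ofConnectedTemperoidData_of_pushforward`,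
via `hfac_atLevelOne_ofConnectedTemperoidYddFamily_of_pushforward`); `hN` is already gone in p447315.  RESIDUAL of (A): `hnd` — at an abstract
monoid vocabulary `V`; at `treeMonoidVocab(Weak)` it is `h44.isNonDilating₁` (`hnd_of_thm44Hyp_treeMonoidVocab(Weak)` above).  Every other
binder of p447315 VERBATIM (`hF`, `hαover`, `hcharN`, `hdivA`, `hP24`, the §4 package `h44 ψ hpull hii h3 h4b h8 h15a h15 D`, `hArises`,
`hebs`, `hroot₁N`, `hivP'`, (C) `hc`).  Morphism universe `0` (the dictionary reads constants in `ℚ̄_p`).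
[cite: MochizukiEtTh2009, Thm 5.7 p.329–330 (PDF pp.103–104); Lem 5.8 p.331 (PDF p.105); Def 3.6 (iii)(iv) p.303–304 (PDF pp.77–78); §5 p.322 (PDF p.96)] -/
theorem thetaRootPreservedAll_ofConnectedTemperoidYddFamily_final_reduced_genuine_of_constantsDictionary
    (T : ThetaFrobenioidTower.{0} (BiKummerSetting.mkOfConnectedTemperoidYddTower X tf hZ hP NH 𝒯 ιX).C
      (ConnectedPart (BTemp X.Pi)))
    (hT : T = ofConnectedTemperoidFamily h Q odd_l R ιX K' (fun N => (Units.map (tf.ratFnFunctor.map (t N).op).hom).comp c₀)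
      (fun N => tf.unitsMap_comp_injective (t N) hc₀ (ht N)) hinvc hinvp α β comm_sCap comm_sCup isIsometry_α degFr_α isIsometry_β
      degFr_β baseFrob_α)
    -- (A), residual at an ABSTRACT monoid vocabulary `V` (print's "`Φ` non-dilating"; at the canonical vocabularies it is
    -- `h44.isNonDilating₁`, see `hnd_of_thm44Hyp_treeMonoidVocab(Weak)` below)
    (hnd : IsNonDilatingOn tf.divisorMonoid)
    -- (A) `hgc₁` RE-KEYED: the ONE junction binder at the first root and the identification of `Π^tp_Y̲`
    {μ₁ : DS.CyclotomeMod l' (T.atLevel 1).N} {ι₁ : (T.atLevel 1).PiX ≃ₜ* (Cu.thetaEnvData μ₁ hC hS).PiX}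
    {m₁ : (T.atLevel 1).muTorsion (T.atLevel 1).BN (T.atLevel 1).N ≃* (Cu.thetaEnvData μ₁ hC hS).mu}
    (α₁ : (T.atLevel 1).BiratAutAction) {Cst₁ : Subgroup ((T.atLevel 1).biratUnits (T.atLevel 1).BN)}
    {ν₁ : Cst₁ →* (PadicAlgCl p)ˣ}
    (hD₁ : ThetaFrobenioid.BiratAutAction.ConstantsDictionary α₁ Cu μ₁ hC hS ι₁ m₁ Cst₁ ν₁)
    (hY₁ : (T.atLevel 1).IdentifiesPiY (Cu.thetaEnvData μ₁ hC hS) ι₁.toMulEquiv)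
    -- (A) `hfac₁` RE-KEYED: Prop. 3.4 (ii), the identification `D → D₀ → D^cnst ≅ aug_* ⋙ G`, and `hYdd`
    {Dcnst : Type u₁} [Category.{v₁} Dcnst] (cnst : D₀ ⥤ Dcnst) (G : ConnectedPart (BTemp (Field.absoluteGaloisGroup K)) ⥤ Dcnst)
    (ecn : tf.base ⋙ cnst ≅ QuasiTemperoid.pushforward X.aug.toMonoidHom X.aug_surjective X.augIsOpenMap_holds ⋙ G)
    (hP34 : RealifiedDivisorMonoids.Prop34Cnst T₀ cnst)
    (hYdd : ∀ y : 𝒯.PiX, ∃ k ∈ 𝒯.PiYdd, X.aug (ιX k) = X.aug (ιX y))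
    -- the rendering law of `pullFrac` (the model's `((·)^birat)^*`), the transitions over the base pair, and the Prop. 2.4-class
    -- clause at the chosen first root ("`S₂^bs` characteristic", p.329): these DISCHARGE `hpull₂`, `hD`, `hf`, `hΨFT`, `hbs` of `…_final`
    (hF : ∀ {B B' : (BiKummerSetting.mkOfConnectedTemperoidYddTower X tf hZ hP NH 𝒯 ιX).C} (φ : B' ⟶ B)
      (y : (BiKummerSetting.mkOfConnectedTemperoidYddTower X tf hZ hP NH 𝒯 ιX).biratUnits B), pullFrac φ y = tf.pullFracModel φ y)
    (hαover : ∀ N : ℕ+, α (one_dvd_level N) ≫ (R 1).α = (R N).α)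
    (hcharN : IsTopCharacteristic X.Pi (galoisSurjOf X.isTempered (R 1).AN.base.obj (R 1).αData.isGalois).ker)
    (hdivA : ∀ αA : h44.Ψ.functor.obj (T.AN 1) ≅ T.AN 1, ∃ ε : Aut (T.AN 1),
      T.pre.div (αA.inv ≫ h44.Ψ.functor.map (T.sCap 1)) = T.pre.div (ε.hom ≫ T.sCap 1) ∧
      T.pre.div (αA.inv ≫ h44.Ψ.functor.map (T.sCup 1)) = T.pre.div (ε.hom ≫ T.sCup 1))
    (hP24 : ∀ γ : 𝒯.PiX ≃ₜ* 𝒯.PiX, 𝒯.PiYdd.map γ.toMulEquiv.toMonoidHom = 𝒯.PiYdd)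
    -- per anchor and level: clause (e) pointwise at the anchor, and the base isomorphism of `Ψ` at `A_N` over `α_{1,N}`
    (hArises : ∀ (α₁ : h44.Ψ.functor.obj (R 1).AN ≅ (R 1).AN) (N : ℕ+),
      (BiKummerSetting.mkOfConnectedTemperoidYddTower X tf hZ hP NH 𝒯 ιX).ArisesFromBaseFrobeniusPair
        ((D N).G.map (h44.Ψ.functor.mapAut (R N).AN)) (h44.Ψ.functor.map (D N).α₂) (h44.Ψ.functor.map (D N).α₁ ≫ α₁.hom))
    (hebs : ∀ (α₁ : h44.Ψ.functor.obj (R 1).AN ≅ (R 1).AN) (N : ℕ+),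
      ∃ ebs : (BiKummerSetting.mkOfConnectedTemperoidYddTower X tf hZ hP NH 𝒯 ιX).base.obj (R N).AN ≅
          (BiKummerSetting.mkOfConnectedTemperoidYddTower X tf hZ hP NH 𝒯 ιX).base.obj (h44.Ψ.functor.obj (R N).AN),
        (BiKummerSetting.mkOfConnectedTemperoidYddTower X tf hZ hP NH 𝒯 ιX).base.map (α (one_dvd_level N)) =
          ebs.hom ≫ (BiKummerSetting.mkOfConnectedTemperoidYddTower X tf hZ hP NH 𝒯 ιX).base.map
            (h44.Ψ.functor.map (α (one_dvd_level N)) ≫ α₁.hom))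
    -- per unit `u₁` and level: `hroot₁N` — an `N`-th root of the level-1 discrepancy unit on `B_N` over `β_{1,N}` (Lem. 5.8 /
    -- Def. 4.1 (iii)), with the `H_{A_N}`-fixedness of the pulled-back twisted function (abc-iut-f-123's reduction p443193)
    (hroot₁N : ∀ (u₁ : Aut (R 1).BN) (hu₁ : u₁ ∈ (BiKummerSetting.mkOfConnectedTemperoidYddTower X tf hZ hP NH 𝒯 ιX).units (R 1).BN)
      (N : ℕ+), ∃ (ut : Aut (R N).BN) (_ : ut ∈ (BiKummerSetting.mkOfConnectedTemperoidYddTower X tf hZ hP NH 𝒯 ιX).units (R N).BN),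
        ut.hom ≫ β (one_dvd_level N) = β (one_dvd_level N) ≫ u₁.hom ∧
        (BiKummerSetting.mkOfConnectedTemperoidYddTower X tf hZ hP NH 𝒯 ιX).IsFixedByHA (R N).AN (R N).isSaturated.isAmple.isGalois
          (pullFrac (D N).α₁
            ((BiKummerSetting.mkOfConnectedTemperoidYddTower X tf hZ hP NH 𝒯 ιX).fracOf (R 1).pair.num ((R 1).pair.den ≫ u₁.hom)
              (R 1).pair.isPreStep_num
              ((BiKummerSetting.mkOfConnectedTemperoidYddTower X tf hZ hP NH 𝒯 ιX).isPreStep_comp_aut (R 1).pair.isPreStep_den u₁)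
              ((BiKummerSetting.mkOfConnectedTemperoidYddTower X tf hZ hP NH 𝒯 ιX).baseEquivalent_comp_unit (R 1).pair.base_eq hu₁))))
    -- Prop. 4.2 (iv) at the `u₁`-twisted level-1 pair
    (hivP' : ∀ (u₁ : Aut (R 1).BN) (hu₁ : u₁ ∈ (BiKummerSetting.mkOfConnectedTemperoidYddTower X tf hZ hP NH 𝒯 ιX).units (R 1).BN)
      (N : ℕ+)
      (R' R'' : (BiKummerSetting.mkOfConnectedTemperoidYddTower X tf hZ hP NH 𝒯 ιX).NthRoot
        ((BiKummerSetting.mkOfConnectedTemperoidYddTower X tf hZ hP NH 𝒯 ιX).fracOf (R 1).pair.num ((R 1).pair.den ≫ u₁.hom)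
          (R 1).pair.isPreStep_num
          ((BiKummerSetting.mkOfConnectedTemperoidYddTower X tf hZ hP NH 𝒯 ιX).isPreStep_comp_aut (R 1).pair.isPreStep_den u₁)
          ((BiKummerSetting.mkOfConnectedTemperoidYddTower X tf hZ hP NH 𝒯 ιX).baseEquivalent_comp_unit (R 1).pair.base_eq hu₁))
        ((R 1).pair.twistUnit u₁ hu₁ rfl
          (BiKummerSetting.disjointSupports_twistUnit h.isDivisorial (R 1).pair u₁)) N pullFrac)
      (ebs : (BiKummerSetting.mkOfConnectedTemperoidYddTower X tf hZ hP NH 𝒯 ιX).base.obj R'.AN ≅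
        (BiKummerSetting.mkOfConnectedTemperoidYddTower X tf hZ hP NH 𝒯 ιX).base.obj R''.AN),
      (BiKummerSetting.mkOfConnectedTemperoidYddTower X tf hZ hP NH 𝒯 ιX).base.map R'.α =
        ebs.hom ≫ (BiKummerSetting.mkOfConnectedTemperoidYddTower X tf hZ hP NH 𝒯 ιX).base.map R''.α →
        ∃ (v : (BiKummerSetting.mkOfConnectedTemperoidYddTower X tf hZ hP NH 𝒯 ιX).mu R'.BN N) (ζA : R'.AN ≅ R''.AN)
          (ζB : R'.BN ≅ R''.BN),
          ζA.hom ≫ R''.pair.num = R'.pair.num ≫ ζB.hom ∧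
          ζA.hom ≫ R''.pair.den = (R'.pair.den ≫ (v : Aut R'.BN).hom) ≫ ζB.hom ∧
          ζA.hom ≫ R''.α = R'.α ∧ ζB.hom ≫ R''.β = R'.β ∧
          (BiKummerSetting.mkOfConnectedTemperoidYddTower X tf hZ hP NH 𝒯 ιX).base.mapIso ζA = ebs)
    -- (C): the level-1 discrepancy constant of every normalised transport is a `2l`-th root of unity
    (hc : ∀ (α₁ : h44.Ψ.functor.obj (T.AN 1) ≅ T.AN 1) (β₁ : h44.Ψ.functor.obj (T.BN 1) ≅ T.BN 1) (u₁ : Aut (T.BN 1))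
      (hu₁ : u₁ ∈ (T.atLevel 1).units (T.BN 1)),
      α₁.inv ≫ h44.Ψ.functor.map (T.sCap 1) ≫ β₁.hom = T.sCap 1 →
      α₁.inv ≫ h44.Ψ.functor.map (T.sCup 1) ≫ β₁.hom = T.sCup 1 ≫ u₁.hom →
        ∀ c : T.Kˣ, (T.atLevel 1).unitsToBirat (T.BN 1) ⟨u₁, hu₁⟩ = T.constEmb 1 c → c ^ (2 * T.l) = 1) :
    T.ThetaRootPreservedAll h44.Ψ :=
  thetaRootPreservedAll_ofConnectedTemperoidYddFamily_final_reduced 𝒯 ιX h Q odd_l R K' hX₀ t c₀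
    (fun N => tf.unitsMap_comp_injective (t N) hc₀ (ht N)) hinvc hinvp α β comm_sCap comm_sCup isIsometry_α degFr_α isIsometry_β
    degFr_β baseFrob_α h44 ψ hpull hii h3 h4b h8 h15a h15 D T hT hnd (hgc_atLevelOne_of_constantsDictionary Cu hC hS T α₁ hD₁ hY₁)
    (hfac_atLevelOne_ofConnectedTemperoidYddFamily_of_pushforward 𝒯 ιX h Q odd_l R K' t c₀ hc₀ ht hinvc hinvp α β comm_sCap comm_sCup
      isIsometry_α degFr_α isIsometry_β degFr_β baseFrob_α T hT cnst G ecn hP34 hYdd)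
    hF hαover hcharN hdivA hP24 hArises hebs hroot₁N hivP' hc


end FinalReduced

section Setting

variable {p : ℕ} [Fact p.Prime] {DS : ThetaSetting p} {ES : DS.EtaleThetaData} {l' : ℕ} {Cu : ES.DoubleUnderline l'}
  {e' : DS.toTemperedCurve.GroupLevelData} {Es : Set ℕ+} (τ : DS.CyclotomeTower l' Es) (hC : DS.Compat) (hS : DS.Sec2Hyps)
  {D₀ : Type} [Category.{v₀} D₀] {V : FrdIMonoidStub.{0}} {T₀ : RealifiedDivisorMonoids (D₀ := D₀) V}
  {VD : FrdICatStub.{1, 0, 0} (ConnectedPart (BTemp (Cu.temperedArithmeticGroup e').Pi))}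
  {tf : TemperedFrobenioid T₀ (ConnectedPart (BTemp (Cu.temperedArithmeticGroup e').Pi)) VD} {hZ : tf.monoidType = MonoidType.Z}
  {hP : ∀ A : (ConnectedPart (BTemp (Cu.temperedArithmeticGroup e').Pi))ᵒᵖ, IsPerfect (tf.Φ.carrier A)}
  {NH : Subgroup (Field.absoluteGaloisGroup DS.K) → tf.category → ℕ+ → Prop}
  {pullFrac : ∀ {A A' : (BiKummerSetting.mkOfConnectedTemperoidYddTower (Cu.temperedArithmeticGroup e') tf hZ hP NH
      (Cu.thetaEnvTower τ hC hS) (ContinuousMulEquiv.refl _)).C} (_ : A' ⟶ A),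
    (BiKummerSetting.mkOfConnectedTemperoidYddTower (Cu.temperedArithmeticGroup e') tf hZ hP NH (Cu.thetaEnvTower τ hC hS)
        (ContinuousMulEquiv.refl _)).biratUnits A →
      (BiKummerSetting.mkOfConnectedTemperoidYddTower (Cu.temperedArithmeticGroup e') tf hZ hP NH (Cu.thetaEnvTower τ hC hS)
        (ContinuousMulEquiv.refl _)).biratUnits A'}
  {θ : (BiKummerSetting.mkOfConnectedTemperoidYddTower (Cu.temperedArithmeticGroup e') tf hZ hP NH (Cu.thetaEnvTower τ hC hS)
      (ContinuousMulEquiv.refl _)).biratUnits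
    (BiKummerSetting.mkOfConnectedTemperoidYddTower (Cu.temperedArithmeticGroup e') tf hZ hP NH (Cu.thetaEnvTower τ hC hS)
      (ContinuousMulEquiv.refl _)).Aodot}
  {Bl : (BiKummerSetting.mkOfConnectedTemperoidYddTower (Cu.temperedArithmeticGroup e') tf hZ hP NH (Cu.thetaEnvTower τ hC hS)
      (ContinuousMulEquiv.refl _)).C}
  {Pl : (BiKummerSetting.mkOfConnectedTemperoidYddTower (Cu.temperedArithmeticGroup e') tf hZ hP NH (Cu.thetaEnvTower τ hC hS)
      (ContinuousMulEquiv.refl _)).FractionPair θ Bl}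
  {Rl : (BiKummerSetting.mkOfConnectedTemperoidYddTower (Cu.temperedArithmeticGroup e') tf hZ hP NH (Cu.thetaEnvTower τ hC hS)
      (ContinuousMulEquiv.refl _)).NthRoot θ Pl Cu.lPNat pullFrac}
  (h : ModelFrobenioid.Hypotheses tf.divisorMonoid tf.ratFnFunctor)
  (Q : FrobenioidTheta.ThetaSubquotientStub.{0} (ConnectedPart (BTemp (Cu.temperedArithmeticGroup e').Pi)))
  (R : ∀ N : ℕ+, (BiKummerSetting.mkOfConnectedTemperoidYddTower (Cu.temperedArithmeticGroup e') tf hZ hP NH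
      (Cu.thetaEnvTower τ hC hS) (ContinuousMulEquiv.refl _)).NthRoot Rl.root Rl.pair N pullFrac)
  (K' : Type) [Field K'] {X₀ : ConnectedPart (BTemp (Cu.temperedArithmeticGroup e').Pi)}
  (hX₀ : ∀ Y : ConnectedPart (BTemp (Cu.temperedArithmeticGroup e').Pi), Subsingleton (Y ⟶ X₀))
  (t : ∀ N : ℕ+, (R N).BN.base ⟶ X₀) (c₀ : K'ˣ →* (tf.ratFnFunctor.obj (op X₀))ˣ)
  (hc₀ : Function.Injective c₀) (ht : ∀ N : ℕ+, Function.Injective (tf.ratFnFunctor.map (t N).op).hom)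
  (hinvc : ∀ (N : ℕ+) (g : Aut (R N).AN.base),
    pull tf.divisorMonoid g.hom (ModelFrobenioid.div (R N).pair.num) = ModelFrobenioid.div (R N).pair.num)
  (hinvp : ∀ (N : ℕ+) (y : (Cu.thetaEnvTower τ hC hS).PiX), y ∈ (Cu.thetaEnvTower τ hC hS).PiYdd →
    pull tf.divisorMonoid ((BiKummerSetting.mkOfConnectedTemperoidYddTower (Cu.temperedArithmeticGroup e') tf hZ hP NH
      (Cu.thetaEnvTower τ hC hS) (ContinuousMulEquiv.refl _)).galoisSurj (R N).AN.base (R N).αData.isGalois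
        ((ContinuousMulEquiv.refl _) y)).hom (ModelFrobenioid.div (R N).pair.den) = ModelFrobenioid.div (R N).pair.den)
  (α : ∀ {N N' : ℕ+}, (N : ℕ) ∣ N' → ((R N').AN ⟶ (R N).AN))
  (β : ∀ {N N' : ℕ+}, (N : ℕ) ∣ N' → ((R N').BN ⟶ (R N).BN))
  (comm_sCap : ∀ {N N' : ℕ+} (hd : (N : ℕ) ∣ N'), (R N').pair.num ≫ β hd = α hd ≫ (R N).pair.num)
  (comm_sCup : ∀ {N N' : ℕ+} (hd : (N : ℕ) ∣ N'), (R N').pair.den ≫ β hd = α hd ≫ (R N).pair.den)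
  (isIsometry_α : ∀ {N N' : ℕ+} (hd : (N : ℕ) ∣ N'),
    ((BiKummerSetting.mkOfConnectedTemperoidYddTower (Cu.temperedArithmeticGroup e') tf hZ hP NH (Cu.thetaEnvTower τ hC hS)
      (ContinuousMulEquiv.refl _)).sec5Stub h).pre.IsIsometry (α hd))
  (degFr_α : ∀ {N N' : ℕ+} (hd : (N : ℕ) ∣ N'),
    (((BiKummerSetting.mkOfConnectedTemperoidYddTower (Cu.temperedArithmeticGroup e') tf hZ hP NH (Cu.thetaEnvTower τ hC hS)
      (ContinuousMulEquiv.refl _)).sec5Stub h).pre.degFr (α hd) : ℕ) * N = N')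
  (isIsometry_β : ∀ {N N' : ℕ+} (hd : (N : ℕ) ∣ N'),
    ((BiKummerSetting.mkOfConnectedTemperoidYddTower (Cu.temperedArithmeticGroup e') tf hZ hP NH (Cu.thetaEnvTower τ hC hS)
      (ContinuousMulEquiv.refl _)).sec5Stub h).pre.IsIsometry (β hd))
  (degFr_β : ∀ {N N' : ℕ+} (hd : (N : ℕ) ∣ N'),
    (((BiKummerSetting.mkOfConnectedTemperoidYddTower (Cu.temperedArithmeticGroup e') tf hZ hP NH (Cu.thetaEnvTower τ hC hS)
      (ContinuousMulEquiv.refl _)).sec5Stub h).pre.degFr (β hd) : ℕ) * N = N')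
  (baseFrob_α : ∀ {N N' : ℕ+} (hd : (N : ℕ) ∣ N'),
    (BiKummerSetting.mkOfConnectedTemperoidYddTower (Cu.temperedArithmeticGroup e') tf hZ hP NH (Cu.thetaEnvTower τ hC hS)
      (ContinuousMulEquiv.refl _)).IsOfBaseFrobeniusType (α hd))

/-- **The input `hYdd` of the re-keyed `hfac₁` is a THEOREM at the Setting**: every `y ∈ Π^tp_X̲̲` has the augmentation of some
`k ∈ Π^tp_Ÿ̲̲` («`Ÿ̲̲` geometrically connected over `K = K̈`», §5 p.322; abc-iut-L2-t4's `hYdd_ofThetaSetting` BY NAME, read for the §2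
tower `Cu.thetaEnvTower τ hC hS` whose `Π^tp_X̲̲`, `Π^tp_Ÿ̲̲` ARE those of every `Cu.thetaEnvData (τ.mod M) hC hS`).
[cite: MochizukiEtTh2009, §5 p.322 (PDF p.96); Prop 2.2 (iii) p.263 (PDF p.37)] -/
theorem hYdd_thetaEnvTower_ofThetaSetting :
    ∀ y : (Cu.thetaEnvTower τ hC hS).PiX, ∃ k ∈ (Cu.thetaEnvTower τ hC hS).PiYdd,
      (Cu.temperedArithmeticGroup e').aug ((ContinuousMulEquiv.refl _) k) =
        (Cu.temperedArithmeticGroup e').aug ((ContinuousMulEquiv.refl _) y) :=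
  fun y => Cu.hYdd_ofThetaSetting e' (τ.mod ⟨1, τ.one_mem⟩) hC hS y

include hc₀ ht in
/-- **The input `hY₁` of the re-keyed `hgc₁` is a THEOREM at the Setting for `ι₁ := id`, `μ₁ := τ.mod 1`**: the level `1` of the tower of
the Setting with `A_⊙^bs := Ÿ̲̲` and pulled-back constants IS abc-iut-L2-t4's `ofThetaSettingData (τ.mod 1)` (`atLevel_ofThetaSettingFamily_eq`,
`rfl`), whose `Π^tp_Y̲` is identified with the model's by `identifiesPiY_ofThetaSettingData` (`𝔉.PiY = Π^tp_Y̲̲ = T.PiY` via `Ker(Π ↠ ℤ)`).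
[cite: MochizukiEtTh2009, Lem 5.9 (iv) p.332 (PDF p.106); §5 p.330–331 (PDF pp.104–105)] -/
theorem identifiesPiY_atLevelOne_ofThetaSettingYddFamily :
    ((ofThetaSettingFamily τ hC hS h Q R K' (fun N => (Units.map (tf.ratFnFunctor.map (t N).op).hom).comp c₀)
        (fun N => tf.unitsMap_comp_injective (t N) hc₀ (ht N)) hinvc hinvp α β comm_sCap comm_sCup isIsometry_α degFr_α
        isIsometry_β degFr_β baseFrob_α).atLevel 1).IdentifiesPiY (Cu.thetaEnvData (τ.mod ⟨1, τ.one_mem⟩) hC hS)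
      (ContinuousMulEquiv.refl _).toMulEquiv :=
  ThetaFrobenioid.identifiesPiY_ofThetaSettingData (τ.mod ⟨1, τ.one_mem⟩) hC hS h Q (R 1) K'
    ((Units.map (tf.ratFnFunctor.map (t 1).op).hom).comp c₀) (tf.unitsMap_comp_injective (t 1) hc₀ (ht 1)) (hinvc 1) (hinvp 1)

include hX₀ h hc₀ ht in
/-- **[EtTh] Theorem 5.7 (root level) at ALL levels for the tower OF THE SETTING with `A_⊙^bs := Ÿ̲̲` and pulled-back constants, ANCHORED
form**: abc-iut-L2-d4's p442166 at `(Π^tp_X̲̲, Cu.thetaEnvTower τ hC hS, id)` (abc-iut-L2-t4's `ofThetaSettingFamily`, `rfl`) with `hN` GONE,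
`hinj` ⟸ {`hc₀`, `ht`}, `hfac₁` ⟸ {`hP34`, `ecn`} (`hYdd` is the THEOREM `hYdd_thetaEnvTower_ofThetaSetting`), `hgc₁` ⟸ {`hD₁ :
ConstantsDictionary` at the first root, `hY₁`} (for `ι₁ := id`, `μ₁ := τ.mod 1` the THEOREM `identifiesPiY_atLevelOne_ofThetaSettingYddFamily`).
RESIDUAL of (A): `hnd` (abstract vocabulary).  Untouched: `αs`, `βs`, `hdivcap₁`, `hdivcup₁`, `hP24`, `hfam`, (C) `hc`.
[cite: MochizukiEtTh2009, Thm 5.7 p.329–330 (PDF pp.103–104); Lem 5.8 p.331 (PDF p.105); §5 p.322 (PDF p.96); Rmk 4.3.2 p.318–319 (PDF pp.92–93)] -/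
theorem thetaRootPreservedAll_ofThetaSettingYddFamily_ofAnchored_genuine_of_constantsDictionary
    (T : ThetaFrobenioidTower.{0} (BiKummerSetting.mkOfConnectedTemperoidYddTower (Cu.temperedArithmeticGroup e') tf hZ hP NH
      (Cu.thetaEnvTower τ hC hS) (ContinuousMulEquiv.refl _)).C (ConnectedPart (BTemp (Cu.temperedArithmeticGroup e').Pi)))
    (hT : T = ofThetaSettingFamily τ hC hS h Q R K' (fun N => (Units.map (tf.ratFnFunctor.map (t N).op).hom).comp c₀)
      (fun N => tf.unitsMap_comp_injective (t N) hc₀ (ht N)) hinvc hinvp α β comm_sCap comm_sCup isIsometry_α degFr_α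
      isIsometry_β degFr_β baseFrob_α)
    -- (A), residual: print's standing hypothesis "`Φ` non-dilating" (Thm. 3.7 (ii) / Cor. 3.8)
    (hnd : IsNonDilatingOn tf.divisorMonoid)
    -- (A) `hgc₁` RE-KEYED: the ONE junction binder at the first root and the identification of `Π^tp_Y̲`
    {μ₁ : DS.CyclotomeMod l' (T.atLevel 1).N} {ι₁ : (T.atLevel 1).PiX ≃ₜ* (Cu.thetaEnvData μ₁ hC hS).PiX}
    {m₁ : (T.atLevel 1).muTorsion (T.atLevel 1).BN (T.atLevel 1).N ≃* (Cu.thetaEnvData μ₁ hC hS).mu}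
    (α₁ : (T.atLevel 1).BiratAutAction) {Cst₁ : Subgroup ((T.atLevel 1).biratUnits (T.atLevel 1).BN)}
    {ν₁ : Cst₁ →* (PadicAlgCl p)ˣ}
    (hD₁ : ThetaFrobenioid.BiratAutAction.ConstantsDictionary α₁ Cu μ₁ hC hS ι₁ m₁ Cst₁ ν₁)
    (hY₁ : (T.atLevel 1).IdentifiesPiY (Cu.thetaEnvData μ₁ hC hS) ι₁.toMulEquiv)
    (Ψ : (BiKummerSetting.mkOfConnectedTemperoidYddTower (Cu.temperedArithmeticGroup e') tf hZ hP NH (Cu.thetaEnvTower τ hC hS)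
        (ContinuousMulEquiv.refl _)).C ≌
      (BiKummerSetting.mkOfConnectedTemperoidYddTower (Cu.temperedArithmeticGroup e') tf hZ hP NH (Cu.thetaEnvTower τ hC hS)
        (ContinuousMulEquiv.refl _)).C)
    -- (A) `hfac₁` RE-KEYED: Prop. 3.4 (ii) and the identification `D → D₀ → D^cnst ≅ aug_* ⋙ G` (`hYdd` is a theorem here)
    {Dcnst : Type u₁} [Category.{v₁} Dcnst] (cnst : D₀ ⥤ Dcnst)
    (G : ConnectedPart (BTemp (Field.absoluteGaloisGroup DS.K)) ⥤ Dcnst)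
    (ecn : tf.base ⋙ cnst ≅ QuasiTemperoid.pushforward (Cu.temperedArithmeticGroup e').aug.toMonoidHom
      (Cu.temperedArithmeticGroup e').aug_surjective (Cu.temperedArithmeticGroup e').augIsOpenMap_holds ⋙ G)
    (hP34 : RealifiedDivisorMonoids.Prop34Cnst T₀ cnst)
    -- the seeds of the anchor at the first root [Thm. 5.10 (i)] and the inputs of abc-iut-w5-d245's producer
    (αs : Ψ.functor.obj (T.AN 1) ≅ T.AN 1) (βs : Ψ.functor.obj (T.BN 1) ≅ T.BN 1)
    (hdivcap₁ : T.pre.div (αs.inv ≫ Ψ.functor.map (T.sCap 1) ≫ βs.hom) = T.pre.div (T.sCap 1))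
    (hdivcup₁ : T.pre.div (αs.inv ≫ Ψ.functor.map (T.sCup 1) ≫ βs.hom) = T.pre.div (T.sCup 1))
    (hP24 : ∀ γ : (Cu.thetaEnvTower τ hC hS).PiX ≃ₜ* (Cu.thetaEnvTower τ hC hS).PiX,
      (Cu.thetaEnvTower τ hC hS).PiYdd.map γ.toMulEquiv.toMonoidHom = (Cu.thetaEnvTower τ hC hS).PiYdd)
    -- the coherent family, for every normalised anchor (abc-iut-f-121's p438241 output shape)
    (hfam : ∀ (α₁ : Ψ.functor.obj (T.AN 1) ≅ T.AN 1) (β₁ : Ψ.functor.obj (T.BN 1) ≅ T.BN 1) (u₁ : Aut (T.BN 1)),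
      u₁ ∈ (T.atLevel 1).units (T.BN 1) →
      α₁.inv ≫ Ψ.functor.map (T.sCap 1) ≫ β₁.hom = T.sCap 1 →
      α₁.inv ≫ Ψ.functor.map (T.sCup 1) ≫ β₁.hom = T.sCup 1 ≫ u₁.hom →
        ∀ N : ℕ+, ∃ (a : Ψ.functor.obj (T.AN N) ≅ T.AN N) (b : Ψ.functor.obj (T.BN N) ≅ T.BN N) (w : Aut (T.BN N)),
          w ∈ (T.atLevel N).units (T.BN N) ∧
          a.inv ≫ Ψ.functor.map (T.sCap N) ≫ b.hom = T.sCap N ∧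
          a.inv ≫ Ψ.functor.map (T.sCup N) ≫ b.hom = T.sCup N ≫ w.hom ∧
          a.inv ≫ Ψ.functor.map (T.α (one_dvd_level N)) ≫ α₁.hom = T.α (one_dvd_level N) ∧
          b.inv ≫ Ψ.functor.map (T.β (one_dvd_level N)) ≫ β₁.hom = T.β (one_dvd_level N))
    -- (C): the level-1 discrepancy constant of every normalised transport is a `2l`-th root of unity
    (hc : ∀ (α₁ : Ψ.functor.obj (T.AN 1) ≅ T.AN 1) (β₁ : Ψ.functor.obj (T.BN 1) ≅ T.BN 1) (u₁ : Aut (T.BN 1))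
      (hu₁ : u₁ ∈ (T.atLevel 1).units (T.BN 1)),
      α₁.inv ≫ Ψ.functor.map (T.sCap 1) ≫ β₁.hom = T.sCap 1 →
      α₁.inv ≫ Ψ.functor.map (T.sCup 1) ≫ β₁.hom = T.sCup 1 ≫ u₁.hom →
        ∀ c : T.Kˣ, (T.atLevel 1).unitsToBirat (T.BN 1) ⟨u₁, hu₁⟩ = T.constEmb 1 c → c ^ (2 * T.l) = 1) :
    T.ThetaRootPreservedAll Ψ :=
  -- (`𝒯 := Cu.thetaEnvTower τ hC hS`, `ιX := id` are read off the type of `R`; passing `ContinuousMulEquiv.refl _` explicitly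
  -- before `X` is determined makes the unifier normalise `Π^tp_X̲̲` and times out)
  thetaRootPreservedAll_ofConnectedTemperoidYddFamily_ofAnchored_genuine_of_constantsDictionary _ _ h Q Cu.odd_lPNat R K' hX₀ t c₀
    hc₀ ht hinvc hinvp α β comm_sCap comm_sCup isIsometry_α degFr_α isIsometry_β degFr_β baseFrob_α Cu hC hS T hT hnd α₁ hD₁ hY₁ Ψ
    cnst G ecn hP34 (hYdd_thetaEnvTower_ofThetaSetting τ hC hS) αs βs hdivcap₁ hdivcup₁ hP24 hfam hc

end Setting
end ThetaFrobenioidTower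

end Literature.AnabelianGeometry.EtaleTheta

end
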